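import Summits.ResolutionOfSingularities.ResolutionOfSingularities.Theorems.PurelyInseparableDim4UniformTrap
import HarnessLib

/-!
# A UNIFORM two-state trap (2/2: the trap and the dead frames) — `TerminatesSomeRule p q`,
# `Terminates1h p q`, `Terminates1h2 p q`, `TerminatesM1 p q`, `SecondaryInvariantExists p q` are false
# for EVERY prime `p` and EVERY `q ≥ 2` (cell `res-dim4-pi`, W3-2 «T-002 for all p»)

[OURS · counted 0] **Negative result about OUR candidate frames v1–v3** — nothing about resolution of
singularities.  Continues `PurelyInseparableDim4UniformTrap` (the specimen `s_ε = (x₃^{q−1}(x₄ + εx₂ + x₂x₄),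
0, {x₂})`, its two permissible coordinate centres, and the literal step `s_ε ⟶ s_{−ε}` along either of them):
here `T = {s₁, s₋₁}` is shown to be an `IsTrap` over every field, the alternating chain is shown to be a
MODE-1h / 1h2 / m1 / HP-permissible branch, and the frames are refuted for every field of characteristic
`p` (`CharP` forms) and for every prime `p` (`𝔽_p` forms, all names in namespace `UniformTrap`), every
`q ≥ 2`; also in characteristic `0`.  The census had these at `p = q = 2` (K-S1-1 `Mode1hTwoCycle`, K-S2-1
`CoordinateTrap`, PR-7 `M1Cycle`) and, for `TerminatesSomeRule p p` at every prime, res-dim4-idea-3's cage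
`CoordinateCage` (landed first, cited); the 1h / 1h2 / m1 / secondary-invariant frames at every `(p, q)` and
the field-generic / characteristic-0 forms are new here.  Frame v4 (`TerminatesInScope`, `NoIsolatedTrap`, `SpineTerminatesSomeRule`) is untouched by
design.  OURS; nothing here proves resolution in dim ≥ 4 / char p; counted 0.
bears_on: LADDER-RESOLUTION:D157-DOOR2 (res-dim4-pi · W3-2). Supports stmt-ResolutionOfSingularities-16155 (helper).
-/

set_option linter.dupNamespace false -- mandated namespace of this single-conjunct summit

namespace Summit.ResolutionOfSingularities.ResolutionOfSingularities.Theorems.PIDim4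

noncomputable section

namespace UniformTrap

open MvPolynomial Finset
open Literature.AlgebraicGeometry.Resolution
open Literature.AlgebraicGeometry.Resolution.Hauser2010
open Literature.AlgebraicGeometry.Resolution.CentreBlowup

variable {K : Type} [Field K] [DecidableEq K]

/-! ## the trap and the dead frames, for every `q ≥ 2` over every field -/

/-- The trap set `T = {s₁, s₋₁}`. [folklore] -/
def T (q : ℕ) : Set (State K) := {st q 1, st q (-1)}

/-- **`T` is a trap** (`q ≥ 2`, any field). [folklore] -/
theorem isTrap {q : ℕ} (hq : 2 ≤ q) : IsTrap q (T (K := K) q) := by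
  intro s hs
  simp only [T, Set.mem_insert_iff, Set.mem_singleton_iff] at hs
  rcases hs with rfl | rfl
  · refine ⟨by rw [show (st q (1 : K)).F = F q 1 from rfl, ordAlong_F (Finset.subset_univ _) (by omega)],
      fun S hS => ⟨st q (-1), by simp [T], ?_⟩⟩
    exact edge_st (subset_of_isPermissibleCentre hq one_ne_zero hS) hq 1
  · refine ⟨by rw [show (st q (-1 : K)).F = F q (-1) from rfl, ordAlong_F (Finset.subset_univ _) (by omega)],
      fun S hS => ⟨st q 1, by simp [T], ?_⟩⟩
    have h := edge_st (subset_of_isPermissibleCentre hq (neg_ne_zero.mpr one_ne_zero) hS) hq (-1 : K)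
    rwa [neg_neg] at h

/-- **`TerminatesSomeRule p q` is false** whenever some field of characteristic `p` exists (here: the given
`K`), for every `q ≥ 2`. [folklore] -/
theorem not_terminatesSomeRule (p : ℕ) [CharP K p] {q : ℕ} (hq : 2 ≤ q) : ¬ TerminatesSomeRule p q :=
  not_terminatesSomeRule_of_trap p q K (T q) (isTrap hq) ⟨st q 1, by simp [T]⟩

/-- The periodic chain `s₁, s₋₁, s₁, …`. [folklore] -/
def chain (q : ℕ) (k : ℕ) : State K := if k % 2 = 0 then st q 1 else st q (-1)

/-- Consecutive terms of the chain are joined by the edge along the LINE `V(z,x₂,x₃,x₄)`. -/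
theorem chain_edge {q : ℕ} (hq : 2 ≤ q) (k : ℕ) : Edge q T123 (chain (K := K) q k) (chain q (k + 1)) := by
  unfold chain
  by_cases hk : k % 2 = 0
  · rw [if_pos hk, if_neg (by omega)]; exact edge_st subset_rfl hq 1
  · rw [if_neg hk, if_pos (by omega)]
    have h := edge_st (K := K) subset_rfl hq (-1); rwa [neg_neg] at h

omit [DecidableEq K] in
/-- The `F` of a chain state is `F_{±1}`, with `±1 ≠ 0`. -/
theorem chain_cases (q k : ℕ) : ∃ ε : K, ε ≠ 0 ∧ chain q k = st q ε := by
  unfold chain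
  by_cases hk : k % 2 = 0
  · exact ⟨1, one_ne_zero, by rw [if_pos hk]⟩
  · exact ⟨-1, neg_ne_zero.mpr one_ne_zero, by rw [if_neg hk]⟩

/-- The chain is a MODE-1h branch. -/
theorem chain_step1h {q : ℕ} (hq : 2 ≤ q) (k : ℕ) : Step1h q (chain (K := K) q k) (chain q (k + 1)) := by
  obtain ⟨ε, hε, h⟩ := chain_cases (K := K) q k
  refine ⟨T123, ?_, chain_edge hq k⟩
  rw [h]; exact isMode1hCentre_T123 hq hε

/-- The chain is an m1 branch. -/
theorem chain_stepM1 {q : ℕ} (hq : 2 ≤ q) (k : ℕ) : StepM1 q (chain (K := K) q k) (chain q (k + 1)) := by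
  obtain ⟨ε, hε, h⟩ := chain_cases (K := K) q k
  refine ⟨T123, ?_, chain_edge hq k⟩
  rw [h]; exact isModeM1Centre_T123 hq hε

/-- The chain is a 1h2 branch. -/
theorem chain_step1h2 {q : ℕ} (hq : 2 ≤ q) (k : ℕ) : Step1h2 q (chain (K := K) q k) (chain q (k + 1)) := by
  obtain ⟨ε, hε, h⟩ := chain_cases (K := K) q k
  refine ⟨T123, ?_, chain_edge hq k⟩
  rw [h]; exact isMode1h2Centre_T123 hq hε

/-- The chain is an HP-permissible branch (conditions (1) ∧ (2)). -/
theorem chain_stepHP {q : ℕ} (hq : 2 ≤ q) (k : ℕ) : StepHP q (chain (K := K) q k) (chain q (k + 1)) := by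
  obtain ⟨ε, _, h⟩ := chain_cases (K := K) q k
  refine ⟨T123, ?_, ?_, chain_edge hq k⟩
  · rw [h]; exact isPermissibleCentre_of_subset (by omega) ε subset_rfl
  · rw [h]; exact perm2_of_subset (by omega) ε subset_rfl

/-- **`Terminates1h p q` is false** (`q ≥ 2`, any field of characteristic `p`). [folklore] -/
theorem not_terminates1h (p : ℕ) [CharP K p] {q : ℕ} (hq : 2 ≤ q) : ¬ Terminates1h p q :=
  fun h => h K ⟨chain q, chain_step1h hq⟩

/-- **`TerminatesM1 p q` is false.** [folklore] -/
theorem not_terminatesM1 (p : ℕ) [CharP K p] {q : ℕ} (hq : 2 ≤ q) : ¬ TerminatesM1 p q :=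
  fun h => h K ⟨chain q, chain_stepM1 hq⟩

/-- **`Terminates1h2 p q` is false.** [folklore] -/
theorem not_terminates1h2 (p : ℕ) [CharP K p] {q : ℕ} (hq : 2 ≤ q) : ¬ Terminates1h2 p q :=
  fun h => h K ⟨chain q, chain_step1h2 hq⟩

/-- **No secondary invariant for MODE 1h** at any `q ≥ 2` (a 2-cycle). [folklore] -/
theorem not_secondaryInvariantExists (p : ℕ) [CharP K p] {q : ℕ} (hq : 2 ≤ q) :
    ¬ SecondaryInvariantExists p q := by
  intro h
  obtain ⟨W, lt, hwf, Φ, hΦ⟩ := h K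
  have h0 := hΦ _ _ (chain_step1h (K := K) hq 0)
  have h1 := hΦ _ _ (chain_step1h (K := K) hq 1)
  simp only [chain, Nat.zero_mod, if_true, Nat.one_mod, if_false, one_ne_zero] at h0 h1
  exact hwf.asymmetric _ _ h0 h1

/-- Nor a renaming-invariant one. [folklore] -/
theorem not_secondaryInvariantExistsSym (p : ℕ) [CharP K p] {q : ℕ} (hq : 2 ≤ q) :
    ¬ SecondaryInvariantExistsSym p q := by
  intro h
  obtain ⟨W, lt, hwf, Φ, hΦ, -⟩ := h K
  have h0 := hΦ _ _ (chain_step1h (K := K) hq 0)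
  have h1 := hΦ _ _ (chain_step1h (K := K) hq 1)
  simp only [chain, Nat.zero_mod, if_true, Nat.one_mod, if_false, one_ne_zero] at h0 h1
  exact hwf.asymmetric _ _ h0 h1

/-! ## corollaries for every prime (class (4,1) and every `e ≥ 1`) and characteristic 0 -/

/-- **For EVERY prime `p` and every `q ≥ 2`, `TerminatesSomeRule p q` is false** (field `𝔽_p`).
(`q = p`: also `Cage.`/root `not_terminatesSomeRule_of_prime` of `…CoordinateCage`, res-dim4-idea-3 /
typ-1, landed first; here every `q` and the simpler `x₁`-free specimen.) [folklore] -/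
theorem not_terminatesSomeRule_prime (p : ℕ) (hp : p.Prime) {q : ℕ} (hq : 2 ≤ q) :
    ¬ TerminatesSomeRule p q := by
  haveI := Fact.mk hp
  exact not_terminatesSomeRule (K := ZMod p) p hq

-- (`∀ p prime, ¬ TerminatesSomeRule p p` itself is `not_terminatesSomeRule_of_prime` of `…CoordinateCage`,
-- res-dim4-idea-3 / typ-1, landed first — not restated here.)

/-- **`Terminates1h p q` is false for every prime `p` and `q ≥ 2`** (K-S1-1 at every prime; so the
question `Terminates1hQuestion` fails at EVERY prime, not only at `2`). [folklore] -/
theorem not_terminates1h_prime (p : ℕ) (hp : p.Prime) {q : ℕ} (hq : 2 ≤ q) : ¬ Terminates1h p q := by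
  haveI := Fact.mk hp
  exact not_terminates1h (K := ZMod p) p hq

/-- `Terminates1h p p` is false for every prime. [folklore] -/
theorem not_terminates1h_prime_self (p : ℕ) (hp : p.Prime) : ¬ Terminates1h p p :=
  not_terminates1h_prime p hp hp.two_le

/-- **`TerminatesM1 p q` is false for every prime `p` and `q ≥ 2`** (PR-7 at every prime). [folklore] -/
theorem not_terminatesM1_prime (p : ℕ) (hp : p.Prime) {q : ℕ} (hq : 2 ≤ q) : ¬ TerminatesM1 p q := by
  haveI := Fact.mk hp
  exact not_terminatesM1 (K := ZMod p) p hq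

/-- **`Terminates1h2 p q` is false for every prime `p` and `q ≥ 2`.** [folklore] -/
theorem not_terminates1h2_prime (p : ℕ) (hp : p.Prime) {q : ℕ} (hq : 2 ≤ q) : ¬ Terminates1h2 p q := by
  haveI := Fact.mk hp
  exact not_terminates1h2 (K := ZMod p) p hq

/-- **`SecondaryInvariantExists p q` is false for every prime `p` and `q ≥ 2`.** [folklore] -/
theorem not_secondaryInvariantExists_prime (p : ℕ) (hp : p.Prime) {q : ℕ} (hq : 2 ≤ q) :
    ¬ SecondaryInvariantExists p q := by
  haveI := Fact.mk hp
  exact not_secondaryInvariantExists (K := ZMod p) p hq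

/-- `SecondaryInvariantExistsSym p q` is false for every prime `p` and `q ≥ 2`. [folklore] -/
theorem not_secondaryInvariantExistsSym_prime (p : ℕ) (hp : p.Prime) {q : ℕ} (hq : 2 ≤ q) :
    ¬ SecondaryInvariantExistsSym p q := by
  haveI := Fact.mk hp
  exact not_secondaryInvariantExistsSym (K := ZMod p) p hq

/-- The same in characteristic `0` (field `ℚ`): the blindness is characteristic-free. [folklore] -/
theorem not_terminatesSomeRule_charZero {q : ℕ} (hq : 2 ≤ q) : ¬ TerminatesSomeRule 0 q :=
  not_terminatesSomeRule (K := ℚ) 0 hq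

/-- `Terminates1h 0 q` is false too (`q ≥ 2`, field `ℚ`). [folklore] -/
theorem not_terminates1h_charZero {q : ℕ} (hq : 2 ≤ q) : ¬ Terminates1h 0 q :=
  not_terminates1h (K := ℚ) 0 hq

end UniformTrap

end

end Summit.ResolutionOfSingularities.ResolutionOfSingularities.Theorems.PIDim4
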